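import Mathlib
import Literature.NumberTheory.Transcendental.SchanuelEclEmptyProofs
import Literature.NumberTheory.Transcendental.GammaFields
import Literature.NumberTheory.Transcendental.GammaFieldsEcl
import Literature.NumberTheory.Transcendental.ZilberFieldHomogeneity
import Summits.Schanuel.Schanuel.Theorems.RigidCoreDefs
import Summits.Schanuel.Schanuel.Theorems.RigidCoreSchanuelOnLogFreeCoreCalibrationB
import Summits.Schanuel.Schanuel.Theorems.RigidCoreSchanuelOnLogFreeCoreExhaust

/-!
# Stub A of line `generic-period-fibre` implies NoPi: `π ∉ M`

Registered stub `stub_calibA_noPi` (S3) of line `generic-period-fibre` of crux `stmt-Schanuel-0970`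
(`Summit.Schanuel.Schanuel.Theses.RigidCore.SchanuelOnLogFreeCore`).  Stub A of the line is
Schanuel's statement for `ℚ`-linearly independent tuples drawn from the KERNEL-FREE CORE
`M = kernelFreeCore = sInf {K ≤ ℂ | K exp-closed, K relatively algebraically closed}`
(`RigidCoreDefs.lean`; an OPEN sub-conjecture of Schanuel's conjecture, taken here as a
HYPOTHESIS).  This file proves

  `A ⟹ π ∉ M`   (`NoPi.pi_not_mem_of_exhaust`, `stub_calibA_noPi`),

i.e. under A the period `2πi` is NOT log-free constructible, so that stub B of the line has content
(`CalibrationB.logFreeCore_eq_kernelFreeCore_iff`: `C_EA = M ⟺ π ∈ M`).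

## Proof: the kernel count along an EA-construction sequence

Suppose `π ∈ M`; then `τ := 2πi ∈ M` (`CalibrationB.pi_mem_kernelFreeCore_iff`), `exp τ = 1`,
`τ ≠ 0`.  By the exhaustion of `M` by EA-construction sequences (stub S3a, landed:
`stub_kernelFreeCore_exhaust`, file `RigidCoreSchanuelOnLogFreeCoreExhaust.lean`) there is
`l : Fin k → ℂ` through `τ`, each `l j` algebraic over `ℚ(l i, exp l i : i < j)`.  For the prefixes
`P_j = {l i : i < j}` we prove (`NoPi.invariant`, by induction on `j`, one step being `NoPi.step`)

  `rk (P_j ∪ exp P_j) + [τ ∈ span_ℚ P_j] ≤ dim_ℚ span_ℚ P_j`,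

where `rk` is the rank function of the algebraic matroid of `ℂ/ℚ` (`GammaField.algMatroid ℂ`,
Mathlib's `AlgebraicIndependent.matroid`; for finite sets it is `trdeg_ℚ ℚ(·)`) and the dimension
is carried as the length `d` of a `ℚ`-basis `y : Fin d → ℂ` of `span P_j` drawn greedily from `P_j`.
The new element `c = l j` is algebraic over `ℚ(P_j, exp P_j)`, so the rank grows by at most one
(`exp c`); if `c ∈ span P_j` the dimension does not grow, but then (KERNEL RELATION,
`NoPi.exp_pow_mem_adjoin`) a power of `exp c` lies in `ℚ(P_j, exp P_j)` and the rank does not grow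
either; if `c ∉ span P_j` the dimension grows by one, and if moreover the indicator jumps
(`τ ∈ span P_{j+1} ∖ span P_j`) then by exchange `c ∈ span (τ, P_j)`, so again — as `exp τ = 1` —
a power of `exp c` lies in `ℚ(P_j, exp P_j)` and the rank does not grow.  At `j = k`:
`rk (range l ∪ exp range l) + 1 ≤ d`.  But the basis `y ⊂ range l ⊂ M`
(`NoPi.mem_kernelFreeCore_of_isConstr`) is `ℚ`-linearly independent, so stub A gives
`d ≤ trdeg ℚ(y, exp y) ≤ rk (range l ∪ exp range l)` (`ZilberHomogeneity.natCast_le_eRk_of_le_trdeg`)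
— a contradiction.

Sources: the kernel count is the standard predimension bookkeeping of exponential fields
(B. Zilber, *Pseudo-exponentiation on algebraically closed fields of characteristic zero*, Ann. Pure
Appl. Logic 132 (2005) §1; J. Kirby, *Exponential algebraicity in exponential fields*, Bull. LMS 42
(2010), arXiv:0810.4285, §3); matroid glue from Mathlib (`Matroid.eRk_insert_le_add_one`,
`Matroid.eRk_closure_eq`) and the tree (`GammaField.acl`, `GammaField.acl_adjoin`,
`ZilberHomogeneity.mem_acl_of_isAlgebraic`, `exists_nsmul_mem_span_int`,
`mem_adjoin_of_mem_span_int`).  NOT claimed: stub A itself, `π ∉ M` unconditionally (open,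
it contains e.g. the irrationality-type statement "`π` is not a log-free EA-number"), or anything
about stub B.  All auxiliaries live in the sub-namespace `…RigidCore.NoPi`; only the registered
stub is declared directly in `Summit.Schanuel.Schanuel.Theorems.RigidCore`.  No definition is
introduced.
-/

noncomputable section

namespace Summit.Schanuel.Schanuel.Theorems.RigidCore

open IntermediateField
open Literature.NumberTheory.Transcendental
open Literature.NumberTheory.Transcendental.GammaField
open Summit.Schanuel.Schanuel.Theorems.AclSubsetLogFreeCore.Negative (isAlgebraic_of_le)

namespace NoPi

/-! ### The kernel relation -/

/-- KERNEL RELATION: if `exp τ = 1` and `c` lies in the `ℚ`-span of `τ` and a set `P`, then a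
positive power of `exp c` lies in `ℚ(P, exp P)` (clear denominators: `N c = m τ + w` with
`w ∈ span_ℤ P`, so `(exp c)^N = (exp τ)^m · exp w = exp w`). -/
theorem exp_pow_mem_adjoin {τ : ℂ} (hτ : Complex.exp τ = 1) {P : Set ℂ} {c : ℂ}
    (hc : c ∈ Submodule.span ℚ (insert τ P)) :
    ∃ N : ℕ, N ≠ 0 ∧ Complex.exp c ^ N ∈ adjoin ℚ (P ∪ Complex.exp '' P) := by
  have hc' : c ∈ Submodule.span ℚ (Set.range (Subtype.val : ↥(insert τ P) → ℂ)) := by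
    rwa [Subtype.range_val]
  obtain ⟨N, hN, hNc⟩ := exists_nsmul_mem_span_int _ hc'
  rw [Subtype.range_val, Submodule.mem_span_insert] at hNc
  obtain ⟨m, w, hw, hmw⟩ := hNc
  have hw' : w ∈ Submodule.span ℤ (Set.range (Subtype.val : ↥P → ℂ)) := by
    rwa [Subtype.range_val]
  have hexpw := (mem_adjoin_of_mem_span_int _ hw').2
  rw [Set.range_comp, Subtype.range_val] at hexpw
  refine ⟨N, hN, ?_⟩
  have key : Complex.exp c ^ N = Complex.exp w := by
    rw [← Complex.exp_nat_mul, ← nsmul_eq_mul, ← Nat.cast_smul_eq_nsmul ℚ, hmw, Complex.exp_add,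
      zsmul_eq_mul, Complex.exp_int_mul, hτ, one_zpow, one_mul]
  rw [key]
  exact hexpw

/-! ### One step of the kernel count -/

/-- ONE STEP of the kernel count.  The invariant for a set `P` (with respect to `τ`,
`exp τ = 1`) is: there is a `ℚ`-linearly independent `y : Fin d → ℂ` drawn from `P` and spanning
`P` with `rk (P ∪ exp P) ≤ d`, and `rk (P ∪ exp P) + 1 ≤ d` if `τ ∈ span_ℚ P` (`rk` = rank in the
algebraic matroid of `ℂ/ℚ`).  It passes from `P` to `insert c P` for every `c` algebraic over
`ℚ(P, exp P)` (i.e. `c ∈ acl (P ∪ exp P)`). -/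
theorem step {τ : ℂ} (hτ : Complex.exp τ = 1) {P : Set ℂ} {c : ℂ}
    (hc : c ∈ acl (P ∪ Complex.exp '' P))
    (h : ∃ (d : ℕ) (y : Fin d → ℂ), LinearIndependent ℚ y ∧ Set.range y ⊆ P ∧
      P ⊆ Submodule.span ℚ (Set.range y) ∧
      (algMatroid ℂ).eRk (P ∪ Complex.exp '' P) ≤ d ∧
      (τ ∈ Submodule.span ℚ P → (algMatroid ℂ).eRk (P ∪ Complex.exp '' P) + 1 ≤ d)) :
    ∃ (d : ℕ) (y : Fin d → ℂ), LinearIndependent ℚ y ∧ Set.range y ⊆ insert c P ∧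
      insert c P ⊆ Submodule.span ℚ (Set.range y) ∧
      (algMatroid ℂ).eRk (insert c P ∪ Complex.exp '' insert c P) ≤ d ∧
      (τ ∈ Submodule.span ℚ (insert c P) →
        (algMatroid ℂ).eRk (insert c P ∪ Complex.exp '' insert c P) + 1 ≤ d) := by
  obtain ⟨d, y, hy, hyP, hPy, hrk, hτrk⟩ := h
  set S : Set ℂ := P ∪ Complex.exp '' P
  have hS' : insert c P ∪ Complex.exp '' insert c P = insert c (insert (Complex.exp c) S) := by
    rw [Set.image_insert_eq, Set.insert_union, Set.union_insert]
  rw [hS']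
  have hspan : Submodule.span ℚ (Set.range y) = Submodule.span ℚ P :=
    le_antisymm (Submodule.span_mono hyP) (Submodule.span_le.2 hPy)
  have hSacl : S ⊆ acl S := subset_acl S
  have hrkS : (algMatroid ℂ).eRk (acl S) = (algMatroid ℂ).eRk S := (algMatroid ℂ).eRk_closure_eq S
  -- if `exp c ∈ acl S` as well, the rank does not grow
  have hflat : Complex.exp c ∈ acl S →
      (algMatroid ℂ).eRk (insert c (insert (Complex.exp c) S)) ≤ (algMatroid ℂ).eRk S :=
    fun hec => ((algMatroid ℂ).eRk_mono
      (Set.insert_subset hc (Set.insert_subset hec hSacl))).trans_eq hrkS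
  -- in general the rank grows by at most one
  have hone : (algMatroid ℂ).eRk (insert c (insert (Complex.exp c) S)) ≤
      (algMatroid ℂ).eRk S + 1 :=
    calc (algMatroid ℂ).eRk (insert c (insert (Complex.exp c) S))
        ≤ (algMatroid ℂ).eRk (insert (Complex.exp c) (acl S)) :=
          (algMatroid ℂ).eRk_mono (Set.insert_subset (Set.mem_insert_of_mem _ hc)
            (Set.insert_subset_insert hSacl))
      _ ≤ (algMatroid ℂ).eRk (acl S) + 1 := (algMatroid ℂ).eRk_insert_le_add_one _ _
      _ = (algMatroid ℂ).eRk S + 1 := by rw [hrkS]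
  -- the kernel relation: `exp c ∈ acl S` as soon as `c ∈ span (τ, P)`
  have hker : c ∈ Submodule.span ℚ (insert τ P) → Complex.exp c ∈ acl S := fun h => by
    obtain ⟨N, hN, hmem⟩ := exp_pow_mem_adjoin hτ h
    exact mem_acl_of_pow_mem hN (adjoin_subset_acl S hmem)
  by_cases hcP : c ∈ Submodule.span ℚ P
  · -- no new dimension, and (kernel relation) no new transcendence
    have hle := hflat (hker (Submodule.span_mono (Set.subset_insert τ P) hcP))
    have hcy : c ∈ Submodule.span ℚ (Set.range y) := by rwa [hspan]
    refine ⟨d, y, hy, hyP.trans (Set.subset_insert c P), Set.insert_subset hcy hPy,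
      hle.trans hrk, fun hτ' => ?_⟩
    rw [Submodule.span_insert_eq_span hcP] at hτ'
    exact (add_le_add hle le_rfl).trans (hτrk hτ')
  · -- one new dimension
    have hcy : c ∉ Submodule.span ℚ (Set.range y) := by rwa [hspan]
    refine ⟨d + 1, Fin.cons c y, hy.finCons hcy, ?_, ?_, ?_, fun hτ' => ?_⟩
    · rw [Fin.range_cons]
      exact Set.insert_subset_insert hyP
    · rw [Fin.range_cons]
      exact Set.insert_subset (Submodule.subset_span (Set.mem_insert c _))
        fun x hx => Submodule.span_mono (Set.subset_insert c _) (hPy hx)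
    · push_cast
      exact hone.trans (add_le_add hrk le_rfl)
    · push_cast
      by_cases hτP : τ ∈ Submodule.span ℚ P
      · exact (add_le_add hone le_rfl).trans (add_le_add (hτrk hτP) le_rfl)
      · -- the indicator jumps: by exchange `c ∈ span (τ, P)`, so no new transcendence
        exact add_le_add ((hflat (hker (mem_span_insert_exchange hτ' hτP))).trans hrk)
          le_rfl

/-! ### The invariant along a construction sequence -/

/-- THE KERNEL COUNT: along an EA-construction sequence `l` (each `l j` algebraic over
`ℚ(l i, exp l i : i < j)`), every prefix `P_j = {l i : i < j}` carries a `ℚ`-linearly independent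
spanning tuple `y : Fin d → ℂ` with `rk (P_j ∪ exp P_j) + [τ ∈ span_ℚ P_j] ≤ d`
(`τ ≠ 0`, `exp τ = 1`).  Induction on `j`, the step being `step`. -/
theorem invariant {τ : ℂ} (hτ : Complex.exp τ = 1) (hτ0 : τ ≠ 0) {k : ℕ} {l : Fin k → ℂ}
    (hl : ∀ j : Fin k, IsAlgebraic
      ↥(adjoin ℚ (l '' {i | i < j} ∪ Complex.exp '' (l '' {i | i < j}))) (l j)) :
    ∀ j : ℕ, j ≤ k →
      ∃ (d : ℕ) (y : Fin d → ℂ), LinearIndependent ℚ y ∧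
        Set.range y ⊆ l '' {i | (i : ℕ) < j} ∧
        l '' {i | (i : ℕ) < j} ⊆ Submodule.span ℚ (Set.range y) ∧
        (algMatroid ℂ).eRk (l '' {i | (i : ℕ) < j} ∪ Complex.exp '' (l '' {i | (i : ℕ) < j})) ≤ d ∧
        (τ ∈ Submodule.span ℚ (l '' {i | (i : ℕ) < j}) →
          (algMatroid ℂ).eRk (l '' {i | (i : ℕ) < j} ∪ Complex.exp '' (l '' {i | (i : ℕ) < j})) +
            1 ≤ d) := by
  intro j
  induction j with
  | zero =>
    intro _
    have h0 : l '' {i : Fin k | (i : ℕ) < 0} = ∅ := by simp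
    rw [h0, Set.image_empty, Set.union_empty, Matroid.eRk_empty, Submodule.span_empty]
    refine ⟨0, Fin.elim0, linearIndependent_empty_type, ?_, Set.empty_subset _, zero_le,
      fun h => absurd ((Submodule.mem_bot ℚ).1 h) hτ0⟩
    rintro _ ⟨i, _⟩
    exact i.elim0
  | succ j ih =>
    intro hjk
    have hj : j < k := Nat.lt_of_succ_le hjk
    have hP : l '' {i : Fin k | (i : ℕ) < j + 1} = insert (l ⟨j, hj⟩) (l '' {i | (i : ℕ) < j}) := by
      have : {i : Fin k | (i : ℕ) < j + 1} = insert (⟨j, hj⟩ : Fin k) {i : Fin k | (i : ℕ) < j} := by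
        ext i
        simp only [Set.mem_setOf_eq, Set.mem_insert_iff, Fin.ext_iff]
        omega
      rw [this, Set.image_insert_eq]
    rw [hP]
    refine step hτ ?_ (ih hj.le)
    rw [← acl_adjoin]
    exact ZilberHomogeneity.mem_acl_of_isAlgebraic (adjoin ℚ _).toSubalgebra (hl ⟨j, hj⟩)

/-! ### `A ⟹ π ∉ M` -/

/-- Members of an EA-construction sequence lie in the kernel-free core `M` (well-founded induction
along the sequence: `l j` is algebraic over `ℚ(l i, exp l i : i < j) ≤ M`, and `M` is `exp`-closed
and relatively algebraically closed).  (Also landed as `Exhaust.mem_kernelFreeCore_of_isConstr`;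
re-proved here so that `pi_not_mem_of_exhaust` does not depend on the exhaustion file.) -/
theorem mem_kernelFreeCore_of_isConstr {k : ℕ} {l : Fin k → ℂ}
    (hl : ∀ j : Fin k, IsAlgebraic
      ↥(adjoin ℚ (l '' {i | i < j} ∪ Complex.exp '' (l '' {i | i < j}))) (l j))
    (j : Fin k) : l j ∈ kernelFreeCore := by
  -- adapted from `Exhaust.mem_of_isConstr` (RigidCoreSchanuelOnLogFreeCoreExhaust.lean)
  induction j using WellFoundedLT.induction with
  | ind j ih =>
    refine mem_kernelFreeCore_of_isAlgebraic (isAlgebraic_of_le (adjoin_le_iff.2 ?_) (hl j))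
    rintro _ (⟨i, hi, rfl⟩ | ⟨_, ⟨i, hi, rfl⟩, rfl⟩)
    · exact ih i hi
    · exact exp_mem_kernelFreeCore (ih i hi)

/-- **Stub A implies NoPi.**  If every element of the kernel-free core `M` is a member of an
EA-construction sequence (`hex`; this is the landed stub `stub_kernelFreeCore_exhaust`) and
Schanuel's statement holds for `ℚ`-linearly independent tuples from `M` (`hA`, stub A of the
line), then `π ∉ M`.  Proof: the kernel count `invariant` along a construction sequence through
`2πi`, and stub A at the final basis. -/
theorem pi_not_mem_of_exhaust
    (hex : ∀ a ∈ kernelFreeCore, ∃ (k : ℕ) (l : Fin k → ℂ), a ∈ Set.range l ∧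
      ∀ j : Fin k, IsAlgebraic
        ↥(adjoin ℚ (l '' {i | i < j} ∪ Complex.exp '' (l '' {i | i < j}))) (l j))
    (hA : ∀ (n : ℕ) (x : Fin n → ℂ), (∀ i, x i ∈ kernelFreeCore) → LinearIndependent ℚ x →
      (n : Cardinal) ≤ Algebra.trdeg ℚ ↥(adjoin ℚ (Set.range x ∪ Set.range (Complex.exp ∘ x)))) :
    (Real.pi : ℂ) ∉ kernelFreeCore := by
  intro hpi
  set τ : ℂ := 2 * ↑Real.pi * Complex.I
  have hτM : τ ∈ kernelFreeCore := CalibrationB.pi_mem_kernelFreeCore_iff.1 hpi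
  have hτ1 : Complex.exp τ = 1 := Complex.exp_two_pi_mul_I
  have hτ0 : τ ≠ 0 :=
    mul_ne_zero (mul_ne_zero two_ne_zero (Complex.ofReal_ne_zero.2 Real.pi_ne_zero))
      Complex.I_ne_zero
  obtain ⟨k, l, ⟨i₀, hi₀⟩, hl⟩ := hex τ hτM
  obtain ⟨d, y, hy, hyP, -, -, hτrk⟩ := invariant hτ1 hτ0 hl k le_rfl
  set P : Set ℂ := l '' {i : Fin k | (i : ℕ) < k}
  have h1 : (algMatroid ℂ).eRk (P ∪ Complex.exp '' P) + 1 ≤ d :=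
    hτrk (Submodule.subset_span ⟨i₀, i₀.2, hi₀⟩)
  -- the final basis lies in `M`: stub A applies to it
  have hyM : ∀ i, y i ∈ kernelFreeCore := fun i => by
    obtain ⟨i', -, hi'⟩ := hyP ⟨i, rfl⟩
    rw [← hi']
    exact mem_kernelFreeCore_of_isConstr hl i'
  have h2 : (d : ℕ∞) ≤ (algMatroid ℂ).eRk (P ∪ Complex.exp '' P) := by
    refine (ZilberHomogeneity.natCast_le_eRk_of_le_trdeg (hA d y hyM hy)).trans
      ((algMatroid ℂ).eRk_mono (Set.union_subset_union hyP ?_))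
    rw [Set.range_comp]
    exact Set.image_mono hyP
  exact lt_irrefl _ ((ENat.add_one_le_iff (ENat.coe_ne_top d)).1 ((add_le_add h2 le_rfl).trans h1))

end NoPi

/-! ## The registered stub -/

/-- **Registered stub `stub_calibA_noPi` (S3) of line `generic-period-fibre`** (signature verbatim):
stub A — Schanuel's statement for `ℚ`-linearly independent tuples from the kernel-free core
`M = sInf {K ≤ ℂ | K exp-closed, relatively algebraically closed}` — implies `π ∉ M` (NoPi: the
period is not log-free constructible, so stub B of the line is not vacuous).  Proof:
`NoPi.pi_not_mem_of_exhaust` (kernel count along EA-construction sequences) fed with the landed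
exhaustion stub `stub_kernelFreeCore_exhaust`; `kernelFreeCore` is this `sInf` by `rfl`. -/
theorem stub_calibA_noPi :
    (∀ (n : ℕ) (x : Fin n → ℂ),
      (∀ i, x i ∈ (sInf {K : IntermediateField ℚ ℂ | (∀ w ∈ K, Complex.exp w ∈ K) ∧
        ∀ w : ℂ, IsAlgebraic K w → w ∈ K} : IntermediateField ℚ ℂ)) →
      LinearIndependent ℚ x →
        (n : Cardinal) ≤ Algebra.trdeg ℚ
          ↥(IntermediateField.adjoin ℚ (Set.range x ∪ Set.range (Complex.exp ∘ x)))) →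
    (Real.pi : ℂ) ∉ (sInf {K : IntermediateField ℚ ℂ | (∀ w ∈ K, Complex.exp w ∈ K) ∧
        ∀ w : ℂ, IsAlgebraic K w → w ∈ K} : IntermediateField ℚ ℂ) :=
  fun hA => NoPi.pi_not_mem_of_exhaust stub_kernelFreeCore_exhaust hA

end Summit.Schanuel.Schanuel.Theorems.RigidCore

end
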